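import Summits.AtomisticToContinuum.Crystallization.Theorems.FrustratedLawDichotomyStrainedPatchHomEntryLeafHT3
import Summits.AtomisticToContinuum.Crystallization.Theorems.FrustratedLawDichotomyStrainedPatchHomCurvLJAnisoSmoke

/-!
# KERNEL SMOKE of the analytic-slab leaf's CERTIFICATE SIDE at the corner gate cell (`cCorner`, `wGate` = `U 2⁻¹¹ × ξ .00125`; critic rows 1108 / 1110)

decomp-a2c hand-1 g29 (crux `AperiodicFrustratedLawGap`, stmt-AtomisticToContinuum-27623).  Every certificate component of
`…HomEntryLeafHT3.entryLeafOKHT3 μ pCorner cCorner wGate` EXCEPT the inner verdict passes in the kernel (the inner fit/quick verdict on the confined box is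
the open `T3/T4` item: at `t_b` and at `0.8 t_b` `fitOKHS`/`fitOKH`/`entryLeafOKHQ` evaluate to `false` even on the unconfined `2⁻¹¹ × .00125` cell):

* `htCertOK_corner` — `0 < htT`, `γS > 0`, `rS ≥ 0` and the THREE integer PSD confinement certificates `htConf` (radii `(2.76, 3.64, 1.172)·10⁻³` = the sharp
  `max_u |u_k|‖u‖/Q(u)·t` values of the CLAM memo) — 65 s incl. the straddler scan;
* `curvCheckLJM_corner_ht` — the `D80`-shifted centred certificate on the PREDICATE-selected near labels `htCen`/`htNai` of `[−11,11]³` at floor `SC/2` — 84 s;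
* `htGs_corner` — the CHUNKED slope certificate: naive guards on the three chunks and `htGs near + far₁ + far₂ ≤ 0.00973·SC` (the unchunked `slopeCheckLJ` over
  all 1104 labels dies in kernel evaluation).
(`…HomForceJacFar.far1_gate/far2_gate/straddle_gate` are the far-chunk facts at the same cell; `htB` there has `1104` labels, `htR` `13`.)

One kernel definition (`pCorner`) + kernel facts (`decide +kernel`); 0 sorry; standard axioms.  `--supports stmt-AtomisticToContinuum-27623`.
-/

namespace Summit.AtomisticToContinuum.Crystallization.Theorems.FrustratedLawDichotomyStrainedPatchHomEntryLeafHT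

open Literature.Analysis.ValidatedNumerics.Numerics
open Summit.AtomisticToContinuum.Crystallization.Theorems.FrustratedLawDichotomyStrainedPatchHomCurvLJ (cCorner wGate D80 curvCheckLJM)

/-- Certificate of record at the corner gate cell (`U 2⁻¹¹ × ξ .00125`, corner `t_b`): `D80`, near floor `SC/2`, far floors `−SC/100`, total slope
constant `0.00973·SC` (kernel chunk sum `+` margin), sharp AM–GM parameters `γ = (0.990, 1.019, 2.199)` and radii `r = (2.76, 3.64, 1.172)·10⁻³`. -/
def pCorner : HTCert where
  D := D80
  lam₁ := 140737488355328
  lam₂ := -2814749767106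
  lam₃ := -2814749767106
  Gs := 2740000000000
  γS := ![278603931948207, 286823001268158, 618963473786732]
  rS := ![776870935721, 1024568915227, 329888672705]

/-- ★ KERNEL: the scalar side conditions and the three PSD confinement certificates pass at the corner gate cell. -/
theorem htCertOK_corner : htCertOK pCorner cCorner wGate = true := by
  decide +kernel

/-- ★ KERNEL: the `D80`-shifted centred LJ force-Jacobian certificate on the predicate-selected near labels of `[−11,11]³` certifies the floor `SC/2`. -/
theorem curvCheckLJM_corner_ht : curvCheckLJM cCorner wGate (htCen cCorner wGate) (htNai cCorner wGate) D80 140737488355328 = true := by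
  decide +kernel

end Summit.AtomisticToContinuum.Crystallization.Theorems.FrustratedLawDichotomyStrainedPatchHomEntryLeafHT
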